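import Summits.BirchSwinnertonDyer.Rank1Residual.Additive.RamifiedOrdinaryLineMatchingModelFree
import HarnessLib

/-!
# MATCHING of ramified ordinary lines under a congruence `E[p] ≃ E₁[p]` from LINE exponents —
# MODEL-FREE, ON the numerical swap locus of the quotient exponents (cells `(5; 4,4)`, `(7; 6,6)`,
# `(7; 6,2|M)`, `(3; 2,2)`), every curve, no twist model, no class hypothesis

HONEST FRAMING (BSD rank-`≤ 1` residual cell `b2b-bsdres`, home
`run/shared/lean/b2b/bsd-rank1-residual/`, lane CLASS-CLOSURE, seat cc-typer-2 = typer of record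
N10 §3.2 / O7 §3.3, team n1011; typer-lane sequel S4 of S3 = `RamifiedOrdinaryLineMatchingModelFree`):
research route, no claim beyond stated classes; census output = EVIDENCE; nothing is booked by this
file; no RESIDUAL-MAP mark moves. Theorems only: NO definition, NO named fact, NO conjecture node.

WHAT. S3 (`IsRamifiedOrdinaryLine.inclusion_mem_iff_of_not_dvd_lcm`) matches the ramified ordinary
lines `C ⊂ E[p^∞]`, `C₁ ⊂ E₁[p^∞]` under every inertia-equivariant `e : E[p] ≃ E₁[p]` from the
QUOTIENT exponents `n, n₁` (`(p − 1) ∤ lcm(n, n₁)`). Where `(p − 1) ∣ e` for the semistability defect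
`e` — `(p; e) = (5; 4)`, `(7; 6)`, `(3; 2)` — that fails for EVERY partner (n1011-r2 ROUTE-2
§II.25.1 (d): 116 of the 138 non-unit `Gord_e346` rows; the `μ`-anchor leg of the printed `e346`
route). This file proves the matching from the LINE exponents instead: if the local inertia group
acts on `C ∩ E[p^∞][p]` through exponent `ℓ` (`σ^ℓ·m = m`) and on `C₁ ∩ E₁[p^∞][p]` through `ℓ₁`,
and `(p − 1) ∤ lcm(ℓ, ℓ₁)`, then `P ∈ C ↔ e P ∈ C₁` (§2). MECHANISM = S3 with line and quotient
exchanged: `σ ∈ I_v` with `χ_p(σ) ≡ g₀` a primitive root; scalars `a, b`, `a₁, b₁` with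
`ab ≡ g₀ ≡ a₁b₁` (Weil pairing, S3 tools) and `a^ℓ ≡ 1 ≡ a₁^{ℓ₁}` (§1 `lineScalar_pow_eq_one`);
`a ≡ b₁` would force `g₀^{lcm(ℓ,ℓ₁)} ≡ 1`; so `a ≢ b₁`, `a₁ ≢ b`, and S3 §1 (Bézout) applies both ways.

THE HALF-POWER ("PARITY") DICTIONARY (§3). Write the level-`p` inertia characters of a ramified
ordinary line as `ω^{1−i}` (line) and `ω^{i}` (quotient) (`det ρ̄ = ω`). As `p − 1` is even, exactly
one of `i`, `1 − i` is even, i.e. EXACTLY ONE of (Q) "`σ^{(p−1)/2}` trivial on `E[p^∞]/C` for all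
`σ ∈ I_v`" (quotient-even), (L) "`σ^{(p−1)/2}` trivial on `C ∩ E[p^∞][p]`" (line-even) holds —
§1 `false_of_lineHalfPow_of_quotHalfPow` proves "not both"; "at least one" is NOT claimed (it needs
`Hom(I_v, ±1) = {1, ω^{(p−1)/2}}`). Two (Q)-curves match by S3 at `n = n₁ = (p−1)/2`
(`inclusion_mem_iff_of_quotHalfPow`); two (L)-curves by §2 at `ℓ = ℓ₁ = (p−1)/2`
(`inclusion_mem_iff_of_lineHalfPow`); a MIXED pair is the genuine swap locus, where a bare
`E[p]`-congruence need NOT respect the `p`-stabilisations (shape `(5; 4,2)`: quotient characters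
`ω³`, `ω²`, line characters `ω²`, `ω³`) — nothing claimed there. With the EXACT quotient character
`ω^{±m(p−1)/e}`, `gcd(m, e) = 1` (defect `2`: `ω^{(p−1)/2}`): (Q) = good ordinary, `e = 3`,
defect `2` (incl. (M)) at `p ≡ 1 (4)`, `e = 4` at `p ≡ 1 (8)`, `e = 6` at `p ≡ 1 (12)`; (L) =
defect `2` (incl. (M)) at `p ≡ 3 (4)`, `e = 4` at `p ≢ 1 (8)`, `e = 6` at `p ≢ 1 (12)`. So the cells
`(5; 4,4)`, `(7; 6,6)`, `(7; 6,2)`, `(7; 6,M)`, `(3; 2,2)` are (L)–(L): matched by §3 — the content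
n1011-p05 located as 'T-ROL-G-PAIR' ("needs the level-`p` inertia characters").

NOT CLAIMED (typed binder shape OFFERED to the prover lineages n1011-p07 T-ROL-EXP / n1011-p05;
`N10/TRANSPORT-TEMPLATE.md` v2.1): the per-curve PRODUCERS of
`hℓ : ∀ σ ∈ I_v, ∀ m ∈ L.plus, p • m = 0 → (res σ)^((p−1)/2) • m = m` — (P-def2-odd) defect-`2`
rows at `p ≡ 3 (mod 4)`: from the quotient SHAPE `D ⊗ χ` (p07 B0
`RamifiedOrdinaryLineExponentTwo.sq_smul_sub_mem_of_quotientShape`) with `χ_{p*} = χ̄_p^{(p−1)/2}`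
on `Γ_ℚ` and `det = χ_p`; (P-e46-odd) `TypeGOrd`, `e ∈ {4, 6}`, `(p−1)/e` odd: from the
Kummer–Deuring good model (p07 A2 `KummerDeuringModel`): `σ ∈ I_v` induces the reduced automorphism
`[ζ_σ^m]`, `ζ_σ = σ(θ)/θ ≡ ω(σ)^{(p−1)/e}`, so the quotient character is EXACTLY `ω^{±m(p−1)/e}`,
`gcd(m, e) = 1`, and `1 ∓ m(p−1)/e` is even. Consumers once a producer lands: n1011-p12 FILE B
`hlines` (`AdditivePotMult/GreenbergVatsalTransferCountModelFree`), p07 FILE C/D shapes, the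
`Gord_e346` congruence links of class-closure R3″ ON the swap locus.

References: Greenberg–Vatsal, Invent. Math. 142 (2000) §2 p. 26, Remark (2.9) [GreenbergVatsal2000];
Emerton–Pollack–Weston (2006) pp. 2–3, §3.1 [EmertonPollackWeston2006]; Silverman *AEC* III.8.1
[SilvermanAEC2009]; Serre, *Local Fields* IV §4 Prop. 17 [SerreLocalFields1979]; Serre–Tate (1968) §2.
-/

noncomputable section

open scoped Classical AddSubgroup

open NumberField IsDedekindDomain Field
  Literature.NumberTheory.GaloisRepresentations
  Literature.NumberTheory.EllipticCurves
  Literature.NumberTheory.EllipticCurves.GreenbergSelmer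
  Literature.NumberTheory.EllipticCurves.EmertonPollackWeston2006
  IsDedekindDomain.HeightOneSpectrum
  Summit.BirchSwinnertonDyer.Rank1Residual.X2
  Summit.BirchSwinnertonDyer.Rank1Residual.X2.GreenbergVatsalTateDatumTorsion
  Summit.BirchSwinnertonDyer.Rank1Residual.Additive.RamifiedOrdinaryLineUniqueModelFree
  Summit.BirchSwinnertonDyer.Rank1Residual.AdditivePotMult.RamifiedLineUnique
open WeierstrassCurve (geomTorsion geomPrimaryTorsion geomTorsion_le_geomPrimaryTorsion)

open Summit.BirchSwinnertonDyer.Rank1Residual.Additive.RamifiedOrdinaryLineInertiaScalars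
  Summit.BirchSwinnertonDyer.Rank1Residual.Additive.RamifiedOrdinaryLineMatchingModelFree

namespace Summit.BirchSwinnertonDyer.Rank1Residual.Additive.RamifiedOrdinaryLineMatchingLineExponent

variable {W W₁ : WeierstrassCurve ℚ} [W.IsElliptic] [W₁.IsElliptic] {p : ℕ} [hp : Fact p.Prime]
  {v : HeightOneSpectrum (𝓞 ℚ)}

/-! ## §1. `a^ℓ ≡ 1` for a line exponent `ℓ`, and "not both parities" -/

/-- **`a^ℓ ≡ 1 (mod p)` for a LINE exponent**: if `(res τ)^ℓ` acts trivially on `C ∩ E[p^∞][p]`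
(`#= p` for a ramified ordinary line) and `res τ` acts there as the scalar `a`, then `a^ℓ = 1` in
`ℤ/p`. LINE twin of `quotScalar_pow_eq_one`. [cite: GreenbergVatsal2000, §2 p. 26] -/
theorem lineScalar_pow_eq_one {L : LocalDatum ℚ ↥(W.geomPrimaryTorsion p) v}
    (hL : IsRamifiedOrdinaryLine W p L) (τ : absoluteGaloisGroup (v.adicCompletion ℚ)) {ℓ : ℕ}
    (hℓ : ∀ m ∈ L.plus, p • m = 0 →
      (absGaloisRestrict ℚ (v.adicCompletion ℚ) τ) ^ ℓ • m = m)
    {a : ℕ}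
    (ha : ∀ m ∈ L.plus, p • m = 0 → absGaloisRestrict ℚ (v.adicCompletion ℚ) τ • m = a • m) :
    ((a : ZMod p)) ^ ℓ = 1 := by
  have hCp := natCard_plus_inf_torsionBy_eq hL
  -- a non-zero `p`-torsion element `t₀ ∈ C`
  set K : AddSubgroup ↥(W.geomPrimaryTorsion p) :=
    L.plus ⊓ (↥(W.geomPrimaryTorsion p))[(p : ℤ)] with hK
  haveI : Finite ↥K := Nat.finite_of_card_ne_zero (by rw [hCp]; exact hp.out.ne_zero)
  have hKne : K ≠ ⊥ := (AddSubgroup.one_lt_card_iff_ne_bot K).mp (by rw [hCp]; exact hp.out.one_lt)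
  obtain ⟨x₀, hx₀⟩ := (AddSubgroup.ne_bot_iff_exists_ne_zero).mp hKne
  have ht₀S : (x₀ : ↥(W.geomPrimaryTorsion p)) ∈ L.plus := (AddSubgroup.mem_inf.1 x₀.2).1
  have ht₀p : p • (x₀ : ↥(W.geomPrimaryTorsion p)) = 0 :=
    AddSubgroup.torsionBy.nsmul_iff.mp (AddSubgroup.mem_inf.1 x₀.2).2
  have ht₀ : (x₀ : ↥(W.geomPrimaryTorsion p)) ≠ 0 := fun h ↦ hx₀ (Subtype.ext h)
  set t₀ : ↥(W.geomPrimaryTorsion p) := x₀.1 with ht₀def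
  set g := absGaloisRestrict ℚ (v.adicCompletion ℚ) τ with hg
  have hcomm : ∀ (c : ℕ) (x : ↥(W.geomPrimaryTorsion p)), g • (c • x) = c • (g • x) := fun c x ↦
    map_nsmul (DistribSMul.toAddMonoidHom ↥(W.geomPrimaryTorsion p) g) c x
  -- `g^j • t₀ = a^j • t₀`
  have hpow : ∀ j : ℕ, g ^ j • t₀ = a ^ j • t₀ := by
    intro j
    induction j with
    | zero => rw [pow_zero, one_smul, pow_zero, one_nsmul]
    | succ j ih =>
      rw [pow_succ', mul_smul, ih, hcomm, ha t₀ ht₀S ht₀p, ← mul_nsmul', ← pow_succ]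
  -- `(a^ℓ - 1) • t₀ = 0` with `t₀` of order `p`
  have hord : addOrderOf t₀ = p := addOrderOf_eq_prime ht₀p ht₀
  have hz : (((a ^ ℓ : ℕ) : ℤ) - 1) • t₀ = 0 := by
    rw [sub_smul, natCast_zsmul, one_zsmul, ← hpow ℓ, hℓ t₀ ht₀S ht₀p, sub_self]
  have hdvd : (p : ℤ) ∣ ((a ^ ℓ : ℕ) : ℤ) - 1 := by
    rw [← hord]; exact (addOrderOf_dvd_iff_zsmul_eq_zero).mpr hz
  have h0 : (((((a ^ ℓ : ℕ) : ℤ) - 1 : ℤ)) : ZMod p) = 0 :=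
    (ZMod.intCast_zmod_eq_zero_iff_dvd _ p).mpr hdvd
  rw [Int.cast_sub, Int.cast_one, sub_eq_zero, Int.cast_natCast, Nat.cast_pow] at h0
  exact h0

/-- **"Not both": a line exponent `ℓ` and a quotient exponent `n` of ONE curve have
`(p − 1) ∣ lcm(ℓ, n)`** (for `σ ∈ I_v` with `χ_p(σ) ≡ g₀` a primitive root: `a^ℓ ≡ 1`, `bⁿ ≡ 1`,
`a b ≡ g₀`, so `g₀^{lcm} ≡ 1`). [cite: GreenbergVatsal2000, §2 p. 26] [cite: SilvermanAEC2009, Prop. III.8.1] -/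
theorem sub_one_dvd_lcm_of_linePow_of_quotPow {L : LocalDatum ℚ ↥(W.geomPrimaryTorsion p) v}
    (hL : IsRamifiedOrdinaryLine W p L) (hpv : ((p : ℕ) : 𝓞 ℚ) ∈ v.asIdeal) {ℓ n : ℕ}
    (hℓ : ∀ σ ∈ absInertia (v.adicCompletion ℚ), ∀ m ∈ L.plus, p • m = 0 →
      (absGaloisRestrict ℚ (v.adicCompletion ℚ) σ) ^ ℓ • m = m)
    (hn : ∀ σ ∈ absInertia (v.adicCompletion ℚ), ∀ m : ↥(W.geomPrimaryTorsion p),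
      (absGaloisRestrict ℚ (v.adicCompletion ℚ) σ) ^ n • m - m ∈ L.plus) :
    (p - 1) ∣ Nat.lcm ℓ n := by
  obtain ⟨σ, hσI, g₀, hχ, u, hug₀, hu⟩ :=
    exists_mem_absInertia_cyclotomicCharacter_primitiveRoot (p := p) hpv
  obtain ⟨a, ha⟩ := exists_lineScalar hL σ
  obtain ⟨x, hx0, hxp, hxgen⟩ := exists_quotGenerator hL
  obtain ⟨b, hbx, hb⟩ := exists_quotScalar σ hxp hxgen
  have haℓ : ((a : ZMod p)) ^ ℓ = 1 := lineScalar_pow_eq_one hL σ (hℓ σ hσI) ha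
  have hbn : ((b : ZMod p)) ^ n = 1 := quotScalar_pow_eq_one σ (hn σ hσI) hx0 hxp hbx
  have hab : ((b : ZMod p)) * (a : ZMod p) = (g₀ : ZMod p) :=
    quotScalar_mul_lineScalar_eq_of_cyclotomicCharacter_eq hL hχ ha hb
  rw [← hug₀] at hab
  by_contra hlcm
  rw [Nat.lcm_comm] at hlcm
  exact lineScalar_ne_quotScalar hab hu hbn haℓ hlcm rfl

/-- Arithmetic: for an odd prime `p`, `(p − 1) ∤ lcm((p−1)/2, (p−1)/2) = (p−1)/2`. [folklore] -/
theorem not_sub_one_dvd_lcm_half_half (hp2 : p ≠ 2) :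
    ¬ (p - 1) ∣ Nat.lcm ((p - 1) / 2) ((p - 1) / 2) := by
  rw [Nat.lcm_self]
  intro h
  have h2 : 2 < p := lt_of_le_of_ne hp.out.two_le (Ne.symm hp2)
  have hpos : 0 < (p - 1) / 2 := Nat.div_pos (by omega) two_pos
  have hlt : (p - 1) / 2 < p - 1 := Nat.div_lt_self (by omega) one_lt_two
  exact absurd (Nat.le_of_dvd hpos h) (not_le.mpr hlt)

/-- **The two parities exclude each other** (`p` odd): inertia cannot act through exponent `(p−1)/2`
BOTH on `C ∩ E[p^∞][p]` and on `E[p^∞]/C`; a MIXED-parity pair is outside both §3 theorems (the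
genuine swap locus). [cite: GreenbergVatsal2000, §2 p. 26] -/
theorem false_of_lineHalfPow_of_quotHalfPow {L : LocalDatum ℚ ↥(W.geomPrimaryTorsion p) v}
    (hp2 : p ≠ 2) (hL : IsRamifiedOrdinaryLine W p L) (hpv : ((p : ℕ) : 𝓞 ℚ) ∈ v.asIdeal)
    (hℓ : ∀ σ ∈ absInertia (v.adicCompletion ℚ), ∀ m ∈ L.plus, p • m = 0 →
      (absGaloisRestrict ℚ (v.adicCompletion ℚ) σ) ^ ((p - 1) / 2) • m = m)
    (hn : ∀ σ ∈ absInertia (v.adicCompletion ℚ), ∀ m : ↥(W.geomPrimaryTorsion p),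
      (absGaloisRestrict ℚ (v.adicCompletion ℚ) σ) ^ ((p - 1) / 2) • m - m ∈ L.plus) : False :=
  not_sub_one_dvd_lcm_half_half hp2 (sub_one_dvd_lcm_of_linePow_of_quotPow hL hpv hℓ hn)

end Summit.BirchSwinnertonDyer.Rank1Residual.Additive.RamifiedOrdinaryLineMatchingLineExponent

/-! ## §2. The matching theorem from LINE exponents -/

namespace Literature.NumberTheory.EllipticCurves.EmertonPollackWeston2006.IsRamifiedOrdinaryLine

open Summit.BirchSwinnertonDyer.Rank1Residual.Additive.RamifiedOrdinaryLineMatchingModelFree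
  Summit.BirchSwinnertonDyer.Rank1Residual.Additive.RamifiedOrdinaryLineInertiaScalars
  Summit.BirchSwinnertonDyer.Rank1Residual.Additive.RamifiedOrdinaryLineUniqueModelFree
  Summit.BirchSwinnertonDyer.Rank1Residual.Additive.RamifiedOrdinaryLineMatchingLineExponent

variable {W W₁ : WeierstrassCurve ℚ} [W.IsElliptic] [W₁.IsElliptic] {p : ℕ} [hp : Fact p.Prime]
  {v : HeightOneSpectrum (𝓞 ℚ)}

/-- **MATCHING OF RAMIFIED ORDINARY LINES UNDER A CONGRUENCE FROM LINE EXPONENTS — model-free.**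
`E, E₁` elliptic over `ℚ`, `v ∋ p`; `L`, `L₁` ramified ordinary lines at `v` on whose `p`-torsion
`C ∩ E[p^∞][p]`, `C₁ ∩ E₁[p^∞][p]` the local inertia group acts through exponents `ℓ`, `ℓ₁` with
`(p − 1) ∤ lcm(ℓ, ℓ₁)`. Then `P ∈ C ↔ e P ∈ C₁` for EVERY inertia-equivariant additive
`e : E[p] ≃ E₁[p]` and every `P ∈ E[p]` (one `σ ∈ I_v` with `χ_p(σ)` a primitive root; `ab ≡ χ_p(σ) ≡
a₁b₁` by the Weil pairing, `a^ℓ ≡ 1 ≡ a₁^{ℓ₁}`; so `a ≢ b₁`, `a₁ ≢ b`; S3 §1 both ways). The LINE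
twin of S3 `inclusion_mem_iff_of_not_dvd_lcm`; swap-locus cells at `ℓ = ℓ₁ = (p−1)/2` in §3.
[cite: GreenbergVatsal2000, §2 p. 26 and Remark (2.9)]
[cite: EmertonPollackWeston2006, pp. 2–3 and §3.1 (eq:ordes) (arXiv:math/0404484 p. 17)]
[cite: SilvermanAEC2009, Prop. III.8.1] -/
theorem inclusion_mem_iff_of_linePow_of_not_dvd_lcm
    {L : LocalDatum ℚ ↥(W.geomPrimaryTorsion p) v} {L₁ : LocalDatum ℚ ↥(W₁.geomPrimaryTorsion p) v}
    (hL : IsRamifiedOrdinaryLine W p L) (hL₁ : IsRamifiedOrdinaryLine W₁ p L₁)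
    (hpv : ((p : ℕ) : 𝓞 ℚ) ∈ v.asIdeal) {ℓ ℓ₁ : ℕ}
    (hℓ : ∀ σ ∈ absInertia (v.adicCompletion ℚ), ∀ m ∈ L.plus, p • m = 0 →
      (absGaloisRestrict ℚ (v.adicCompletion ℚ) σ) ^ ℓ • m = m)
    (hℓ₁ : ∀ σ ∈ absInertia (v.adicCompletion ℚ), ∀ m ∈ L₁.plus, p • m = 0 →
      (absGaloisRestrict ℚ (v.adicCompletion ℚ) σ) ^ ℓ₁ • m = m)
    (hlcm : ¬ (p - 1) ∣ Nat.lcm ℓ ℓ₁)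
    (e : ↥(geomTorsion W (p : ℤ)) ≃+ ↥(geomTorsion W₁ (p : ℤ)))
    (he : ∀ σ ∈ absInertia (v.adicCompletion ℚ), ∀ P : ↥(geomTorsion W (p : ℤ)),
      e (absGaloisRestrict ℚ (v.adicCompletion ℚ) σ • P) =
        absGaloisRestrict ℚ (v.adicCompletion ℚ) σ • e P)
    (P : ↥(geomTorsion W (p : ℤ))) :
    AddSubgroup.inclusion (geomTorsion_le_geomPrimaryTorsion W p) P ∈ L.plus ↔
      AddSubgroup.inclusion (geomTorsion_le_geomPrimaryTorsion W₁ p) (e P) ∈ L₁.plus := by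
  -- one inertia element with `χ_p(σ)` a primitive root mod `p`
  obtain ⟨σ, hσI, g₀, hχ, u, hug₀, hu⟩ :=
    exists_mem_absInertia_cyclotomicCharacter_primitiveRoot (p := p) hpv
  set g := absGaloisRestrict ℚ (v.adicCompletion ℚ) σ with hg
  -- scalars on `E`
  obtain ⟨a, ha⟩ := exists_lineScalar hL σ
  obtain ⟨x, hx0, hxp, hxgen⟩ := exists_quotGenerator hL
  obtain ⟨b, hbx, hb⟩ := exists_quotScalar σ hxp hxgen
  have haℓ : ((a : ZMod p)) ^ ℓ = 1 := lineScalar_pow_eq_one hL σ (hℓ σ hσI) ha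
  have hab : ((b : ZMod p)) * (a : ZMod p) = (g₀ : ZMod p) :=
    quotScalar_mul_lineScalar_eq_of_cyclotomicCharacter_eq hL hχ ha hb
  -- scalars on `E₁`
  obtain ⟨a₁, ha₁⟩ := exists_lineScalar hL₁ σ
  obtain ⟨x₁, hx₁0, hx₁p, hx₁gen⟩ := exists_quotGenerator hL₁
  obtain ⟨b₁, hb₁x, hb₁⟩ := exists_quotScalar σ hx₁p hx₁gen
  have ha₁ℓ : ((a₁ : ZMod p)) ^ ℓ₁ = 1 := lineScalar_pow_eq_one hL₁ σ (hℓ₁ σ hσI) ha₁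
  have hab₁ : ((b₁ : ZMod p)) * (a₁ : ZMod p) = (g₀ : ZMod p) :=
    quotScalar_mul_lineScalar_eq_of_cyclotomicCharacter_eq hL₁ hχ ha₁ hb₁
  rw [← hug₀] at hab hab₁
  have hab' : ((a : ZMod p)) * (b : ZMod p) = (u : ZMod p) := by rw [mul_comm]; exact hab
  have hab₁' : ((a₁ : ZMod p)) * (b₁ : ZMod p) = (u : ZMod p) := by rw [mul_comm]; exact hab₁
  -- separation (S3's arithmetic lemma with line and quotient exchanged)
  have hsep : (a : ZMod p) ≠ (b₁ : ZMod p) :=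
    (lineScalar_ne_quotScalar hab₁' hu ha₁ℓ haℓ (by rwa [Nat.lcm_comm] at hlcm)).symm
  have hsep₁ : (a₁ : ZMod p) ≠ (b : ZMod p) :=
    (lineScalar_ne_quotScalar hab' hu haℓ ha₁ℓ hlcm).symm
  refine ⟨fun hP ↦ inclusion_apply_mem_of_scalars L L₁ e (he σ hσI) ha hb₁ hsep P hP, fun hP ↦ ?_⟩
  have he' : ∀ Q : ↥(geomTorsion W₁ (p : ℤ)), e.symm (g • Q) = g • e.symm Q := fun Q ↦
    e.injective (by rw [e.apply_symm_apply, he σ hσI, e.apply_symm_apply])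
  have h := inclusion_apply_mem_of_scalars L₁ L e.symm he' ha₁ hb hsep₁ (e P) hP
  rwa [e.symm_apply_apply] at h

/-- **The `Γ_ℚ`-equivariant form** (the binder shape of the `TorsionIso` clause of
`GreenbergVatsal2000.muLambdaAlg_transfer_of_torsionIso_potOrd_of_not_dvd_torsionOrder` and of
n1011-p12's `hlines`): for every `Γ_ℚ`-equivariant `e : E[p] ≃+ E₁[p]`, `P ∈ C ↔ e P ∈ C₁`, from
line exponents `ℓ, ℓ₁` with `(p − 1) ∤ lcm(ℓ, ℓ₁)`. [cite: GreenbergVatsal2000, §2 p. 26 and Remark (2.9)]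
[cite: EmertonPollackWeston2006, pp. 2–3 and §3.1 (eq:ordes) (arXiv:math/0404484 p. 17)] -/
theorem inclusion_mem_iff_of_linePow_of_not_dvd_lcm_of_equivariant
    {L : LocalDatum ℚ ↥(W.geomPrimaryTorsion p) v} {L₁ : LocalDatum ℚ ↥(W₁.geomPrimaryTorsion p) v}
    (hL : IsRamifiedOrdinaryLine W p L) (hL₁ : IsRamifiedOrdinaryLine W₁ p L₁)
    (hpv : ((p : ℕ) : 𝓞 ℚ) ∈ v.asIdeal) {ℓ ℓ₁ : ℕ}
    (hℓ : ∀ σ ∈ absInertia (v.adicCompletion ℚ), ∀ m ∈ L.plus, p • m = 0 →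
      (absGaloisRestrict ℚ (v.adicCompletion ℚ) σ) ^ ℓ • m = m)
    (hℓ₁ : ∀ σ ∈ absInertia (v.adicCompletion ℚ), ∀ m ∈ L₁.plus, p • m = 0 →
      (absGaloisRestrict ℚ (v.adicCompletion ℚ) σ) ^ ℓ₁ • m = m)
    (hlcm : ¬ (p - 1) ∣ Nat.lcm ℓ ℓ₁)
    (e : ↥(geomTorsion W (p : ℤ)) ≃+ ↥(geomTorsion W₁ (p : ℤ)))
    (he : ∀ (σ : absoluteGaloisGroup ℚ) (P : ↥(geomTorsion W (p : ℤ))), e (σ • P) = σ • e P)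
    (P : ↥(geomTorsion W (p : ℤ))) :
    AddSubgroup.inclusion (geomTorsion_le_geomPrimaryTorsion W p) P ∈ L.plus ↔
      AddSubgroup.inclusion (geomTorsion_le_geomPrimaryTorsion W₁ p) (e P) ∈ L₁.plus :=
  hL.inclusion_mem_iff_of_linePow_of_not_dvd_lcm hL₁ hpv hℓ hℓ₁ hlcm e
    (fun σ _ P ↦ he (absGaloisRestrict ℚ (v.adicCompletion ℚ) σ) P) P

/-- **Existential packaging** (p07's `exists_lines_matching_*` shape), from line exponents; by S1
uniqueness "any" and "some" lines are the same. [cite: GreenbergVatsal2000, §2 p. 26 and Remark (2.9)] -/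
theorem exists_lines_matching_of_linePow_of_not_dvd_lcm
    {L : LocalDatum ℚ ↥(W.geomPrimaryTorsion p) v} {L₁ : LocalDatum ℚ ↥(W₁.geomPrimaryTorsion p) v}
    (hL : IsRamifiedOrdinaryLine W p L) (hL₁ : IsRamifiedOrdinaryLine W₁ p L₁)
    (hpv : ((p : ℕ) : 𝓞 ℚ) ∈ v.asIdeal) {ℓ ℓ₁ : ℕ}
    (hℓ : ∀ σ ∈ absInertia (v.adicCompletion ℚ), ∀ m ∈ L.plus, p • m = 0 →
      (absGaloisRestrict ℚ (v.adicCompletion ℚ) σ) ^ ℓ • m = m)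
    (hℓ₁ : ∀ σ ∈ absInertia (v.adicCompletion ℚ), ∀ m ∈ L₁.plus, p • m = 0 →
      (absGaloisRestrict ℚ (v.adicCompletion ℚ) σ) ^ ℓ₁ • m = m)
    (hlcm : ¬ (p - 1) ∣ Nat.lcm ℓ ℓ₁) :
    ∃ (L' : LocalDatum ℚ ↥(W.geomPrimaryTorsion p) v)
      (L₁' : LocalDatum ℚ ↥(W₁.geomPrimaryTorsion p) v),
      IsRamifiedOrdinaryLine W p L' ∧ IsRamifiedOrdinaryLine W₁ p L₁' ∧
      ∀ e : ↥(geomTorsion W (p : ℤ)) ≃+ ↥(geomTorsion W₁ (p : ℤ)),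
        (∀ (σ : absoluteGaloisGroup ℚ) (P : ↥(geomTorsion W (p : ℤ))), e (σ • P) = σ • e P) →
        ∀ P : ↥(geomTorsion W (p : ℤ)),
          AddSubgroup.inclusion (geomTorsion_le_geomPrimaryTorsion W p) P ∈ L'.plus ↔
            AddSubgroup.inclusion (geomTorsion_le_geomPrimaryTorsion W₁ p) (e P) ∈ L₁'.plus :=
  ⟨L, L₁, hL, hL₁, fun e he P ↦
    hL.inclusion_mem_iff_of_linePow_of_not_dvd_lcm_of_equivariant hL₁ hpv hℓ hℓ₁ hlcm e he P⟩

/-! ## §3. The half-power ("parity") forms at `ℓ = ℓ₁ = (p−1)/2` and `n = n₁ = (p−1)/2` -/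

/-- **Two LINE-EVEN curves match** (`p` odd; §2 at `ℓ = ℓ₁ = (p−1)/2`): the matching on the
swap-locus cells `(5; 4,4)`, `(7; 6,6)`, `(7; 6,2)`, `(7; 6,M)`, `(3; 2,2)` of the parity dictionary,
modulo the per-curve producers (P-def2-odd) / (P-e46-odd) of `hℓ`, NOT supplied here.
[cite: GreenbergVatsal2000, §2 p. 26 and Remark (2.9)]
[cite: EmertonPollackWeston2006, pp. 2–3 and §3.1 (eq:ordes) (arXiv:math/0404484 p. 17)] -/
theorem inclusion_mem_iff_of_lineHalfPow
    {L : LocalDatum ℚ ↥(W.geomPrimaryTorsion p) v} {L₁ : LocalDatum ℚ ↥(W₁.geomPrimaryTorsion p) v}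
    (hp2 : p ≠ 2) (hL : IsRamifiedOrdinaryLine W p L) (hL₁ : IsRamifiedOrdinaryLine W₁ p L₁)
    (hpv : ((p : ℕ) : 𝓞 ℚ) ∈ v.asIdeal)
    (hℓ : ∀ σ ∈ absInertia (v.adicCompletion ℚ), ∀ m ∈ L.plus, p • m = 0 →
      (absGaloisRestrict ℚ (v.adicCompletion ℚ) σ) ^ ((p - 1) / 2) • m = m)
    (hℓ₁ : ∀ σ ∈ absInertia (v.adicCompletion ℚ), ∀ m ∈ L₁.plus, p • m = 0 →
      (absGaloisRestrict ℚ (v.adicCompletion ℚ) σ) ^ ((p - 1) / 2) • m = m)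
    (e : ↥(geomTorsion W (p : ℤ)) ≃+ ↥(geomTorsion W₁ (p : ℤ)))
    (he : ∀ σ ∈ absInertia (v.adicCompletion ℚ), ∀ P : ↥(geomTorsion W (p : ℤ)),
      e (absGaloisRestrict ℚ (v.adicCompletion ℚ) σ • P) =
        absGaloisRestrict ℚ (v.adicCompletion ℚ) σ • e P)
    (P : ↥(geomTorsion W (p : ℤ))) :
    AddSubgroup.inclusion (geomTorsion_le_geomPrimaryTorsion W p) P ∈ L.plus ↔
      AddSubgroup.inclusion (geomTorsion_le_geomPrimaryTorsion W₁ p) (e P) ∈ L₁.plus :=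
  hL.inclusion_mem_iff_of_linePow_of_not_dvd_lcm hL₁ hpv hℓ hℓ₁
    (not_sub_one_dvd_lcm_half_half hp2) e he P

/-- **Two LINE-EVEN curves: existential packaging** (p07's `exists_lines_matching_*` shape).
[cite: GreenbergVatsal2000, §2 p. 26 and Remark (2.9)] -/
theorem exists_lines_matching_of_lineHalfPow
    {L : LocalDatum ℚ ↥(W.geomPrimaryTorsion p) v} {L₁ : LocalDatum ℚ ↥(W₁.geomPrimaryTorsion p) v}
    (hp2 : p ≠ 2) (hL : IsRamifiedOrdinaryLine W p L) (hL₁ : IsRamifiedOrdinaryLine W₁ p L₁)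
    (hpv : ((p : ℕ) : 𝓞 ℚ) ∈ v.asIdeal)
    (hℓ : ∀ σ ∈ absInertia (v.adicCompletion ℚ), ∀ m ∈ L.plus, p • m = 0 →
      (absGaloisRestrict ℚ (v.adicCompletion ℚ) σ) ^ ((p - 1) / 2) • m = m)
    (hℓ₁ : ∀ σ ∈ absInertia (v.adicCompletion ℚ), ∀ m ∈ L₁.plus, p • m = 0 →
      (absGaloisRestrict ℚ (v.adicCompletion ℚ) σ) ^ ((p - 1) / 2) • m = m) :
    ∃ (L' : LocalDatum ℚ ↥(W.geomPrimaryTorsion p) v)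
      (L₁' : LocalDatum ℚ ↥(W₁.geomPrimaryTorsion p) v),
      IsRamifiedOrdinaryLine W p L' ∧ IsRamifiedOrdinaryLine W₁ p L₁' ∧
      ∀ e : ↥(geomTorsion W (p : ℤ)) ≃+ ↥(geomTorsion W₁ (p : ℤ)),
        (∀ (σ : absoluteGaloisGroup ℚ) (P : ↥(geomTorsion W (p : ℤ))), e (σ • P) = σ • e P) →
        ∀ P : ↥(geomTorsion W (p : ℤ)),
          AddSubgroup.inclusion (geomTorsion_le_geomPrimaryTorsion W p) P ∈ L'.plus ↔
            AddSubgroup.inclusion (geomTorsion_le_geomPrimaryTorsion W₁ p) (e P) ∈ L₁'.plus :=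
  hL.exists_lines_matching_of_linePow_of_not_dvd_lcm hL₁ hpv hℓ hℓ₁
    (not_sub_one_dvd_lcm_half_half hp2)

/-- **Two QUOTIENT-EVEN curves match** (`p` odd): S3 `inclusion_mem_iff_of_not_dvd_lcm` at
`n = n₁ = (p−1)/2` (good ordinary, `e = 3`, defect `2` at `p ≡ 1 (4)`, `e = 4` at `p ≡ 1 (8)`, `e = 6`
at `p ≡ 1 (12)` among themselves; `hn` = p07's T-ROL-EXP exponent composed with `quotPow_of_dvd`).
[cite: GreenbergVatsal2000, §2 p. 26 and Remark (2.9)]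
[cite: EmertonPollackWeston2006, pp. 2–3 and §3.1 (eq:ordes) (arXiv:math/0404484 p. 17)] -/
theorem inclusion_mem_iff_of_quotHalfPow
    {L : LocalDatum ℚ ↥(W.geomPrimaryTorsion p) v} {L₁ : LocalDatum ℚ ↥(W₁.geomPrimaryTorsion p) v}
    (hp2 : p ≠ 2) (hL : IsRamifiedOrdinaryLine W p L) (hL₁ : IsRamifiedOrdinaryLine W₁ p L₁)
    (hpv : ((p : ℕ) : 𝓞 ℚ) ∈ v.asIdeal)
    (hn : ∀ σ ∈ absInertia (v.adicCompletion ℚ), ∀ m : ↥(W.geomPrimaryTorsion p),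
      (absGaloisRestrict ℚ (v.adicCompletion ℚ) σ) ^ ((p - 1) / 2) • m - m ∈ L.plus)
    (hn₁ : ∀ σ ∈ absInertia (v.adicCompletion ℚ), ∀ m : ↥(W₁.geomPrimaryTorsion p),
      (absGaloisRestrict ℚ (v.adicCompletion ℚ) σ) ^ ((p - 1) / 2) • m - m ∈ L₁.plus)
    (e : ↥(geomTorsion W (p : ℤ)) ≃+ ↥(geomTorsion W₁ (p : ℤ)))
    (he : ∀ σ ∈ absInertia (v.adicCompletion ℚ), ∀ P : ↥(geomTorsion W (p : ℤ)),
      e (absGaloisRestrict ℚ (v.adicCompletion ℚ) σ • P) =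
        absGaloisRestrict ℚ (v.adicCompletion ℚ) σ • e P)
    (P : ↥(geomTorsion W (p : ℤ))) :
    AddSubgroup.inclusion (geomTorsion_le_geomPrimaryTorsion W p) P ∈ L.plus ↔
      AddSubgroup.inclusion (geomTorsion_le_geomPrimaryTorsion W₁ p) (e P) ∈ L₁.plus :=
  hL.inclusion_mem_iff_of_not_dvd_lcm hL₁ hpv hn hn₁ (not_sub_one_dvd_lcm_half_half hp2) e he P

omit [W.IsElliptic] hp in
/-- **Quotient exponents divide up**: an exponent `n` with `n ∣ n'` gives exponent `n'` (so p07's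
T-ROL-EXP exponent `e = semistabilityIndex` feeds `inclusion_mem_iff_of_quotHalfPow` whenever
`e ∣ (p−1)/2`). [folklore] -/
theorem quotPow_of_dvd {L : LocalDatum ℚ ↥(W.geomPrimaryTorsion p) v} {n n' : ℕ} (hnn' : n ∣ n')
    (hn : ∀ σ ∈ absInertia (v.adicCompletion ℚ), ∀ m : ↥(W.geomPrimaryTorsion p),
      (absGaloisRestrict ℚ (v.adicCompletion ℚ) σ) ^ n • m - m ∈ L.plus) :
    ∀ σ ∈ absInertia (v.adicCompletion ℚ), ∀ m : ↥(W.geomPrimaryTorsion p),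
      (absGaloisRestrict ℚ (v.adicCompletion ℚ) σ) ^ n' • m - m ∈ L.plus := by
  intro σ hσ m
  obtain ⟨k, rfl⟩ := hnn'
  set g := absGaloisRestrict ℚ (v.adicCompletion ℚ) σ with hg
  -- `(g^n)^k • m - m ∈ C` by induction on `k`
  induction k with
  | zero => rw [mul_zero, pow_zero, one_smul, sub_self]; exact L.plus.zero_mem
  | succ k ih =>
    have h1 : g ^ (n * (k + 1)) • m - m = g ^ n • (g ^ (n * k) • m - m) + (g ^ n • m - m) := by
      rw [mul_add, mul_one, smul_sub, sub_add_sub_cancel, ← mul_smul, ← pow_add, add_comm (n * k) n]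
    rw [h1]
    refine L.plus.add_mem ?_ (hn σ hσ m)
    have hσn : σ ^ n ∈ absInertia (v.adicCompletion ℚ) := Subgroup.pow_mem _ hσ n
    have h2 : g ^ n = absGaloisRestrict ℚ (v.adicCompletion ℚ) (σ ^ n) := by rw [hg, map_pow]
    rw [h2]
    exact (L.smul_mem (σ ^ n) ih)

omit [W.IsElliptic] hp in
/-- **Line exponents divide up**: an exponent `ℓ` on `C ∩ E[p^∞][p]` with `ℓ ∣ ℓ'` gives exponent
`ℓ'`. [folklore] -/
theorem linePow_of_dvd {L : LocalDatum ℚ ↥(W.geomPrimaryTorsion p) v} {ℓ ℓ' : ℕ} (hℓℓ' : ℓ ∣ ℓ')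
    (hℓ : ∀ σ ∈ absInertia (v.adicCompletion ℚ), ∀ m ∈ L.plus, p • m = 0 →
      (absGaloisRestrict ℚ (v.adicCompletion ℚ) σ) ^ ℓ • m = m) :
    ∀ σ ∈ absInertia (v.adicCompletion ℚ), ∀ m ∈ L.plus, p • m = 0 →
      (absGaloisRestrict ℚ (v.adicCompletion ℚ) σ) ^ ℓ' • m = m := by
  intro σ hσ m hm hpm
  obtain ⟨k, rfl⟩ := hℓℓ'
  induction k with
  | zero => rw [mul_zero, pow_zero, one_smul]
  | succ k ih => rw [Nat.mul_succ, pow_add, mul_smul, hℓ σ hσ m hm hpm, ih]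

end Literature.NumberTheory.EllipticCurves.EmertonPollackWeston2006.IsRamifiedOrdinaryLine

end
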